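import Literature.NumberTheory.DiophantineApproximation.PolylogShiftHermitePade
import Literature.NumberTheory.DiophantineApproximation.DilogHermitePadeArithmetic
import HarnessLib

/-!
# Type-I Hermite–Padé forms for the shifted polylogarithms `Φ_{s,r}(1/M)` — integrality and size of the coefficients

Topic `Literature/NumberTheory/DiophantineApproximation`. For partial-fraction data `c` of the
weight-`w` `m`-SHIFT kernel (`ShiftPade.kernelM`, vocabulary in `PolylogShiftHermitePade.lean`; the
distinct-shifts form of David–Hirata-Kohno–Kawashima 2020, Thm 2.1, shifts `r/m`) with
`d_n^{w−1−o} c_{o,p} ∈ ℤ` (`BallRivoal.IsInt w d_n c`, `d_n = lcm(1..n) = Nat.lcmUpto n`), the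
coefficients of the form `Λ^{(m,w)}_n(1/M) = ∑_{o<w} ∑_{r ≤ m} a_{o,r} Φ_{o+1,r}(1/M) + a`
(`ShiftPade.coefM`, `ShiftPade.constShift`) become integers after multiplication by `d_n^w`
(`isInt_lcmUpto_pow_mul_coefM`, `isInt_lcmUpto_pow_mul_constShift`: the finite remainders have the
denominators `(mk + p % m + 1)^{o+1}` with `k < p/m`, so that
`1 ≤ mk + p % m + 1 ≤ m (p/m) + p % m + 1 − m = p + 1 − m ≤ n`, all dividing `d_n^{o+1}`), and
`|a_{o,r}| ≤ (∑|c|) · M^{n/m}` (`abs_coefM_le`; natural division `n/m`, the point of the shift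
reduction: height `M^{n/m}` against smallness `(m²/M)^{wn}`). Finally `prod_pow_two_pow_le_shiftM` is
the crude bound `∏_{s<w} m^{2n} 2^{(ms+3)n+1} ≤ m^{2nw} 2^{w((mw+3)n+1)}` on the `ℓ¹`-estimate of the
data. This is the `m`-shift counterpart of `PolylogTwoPointHermitePadeForms.lean` (`m = 2`:
`ParityPade.isInt_lcmUpto_pow_mul_coefLi`, `ParityPade.isInt_lcmUpto_pow_mul_constH`,
`ParityPade.abs_coefLi_le`, `ParityPade.prod_two_pow_le`). Everything is PROVED; no definitions, no
named facts.

References: S. David, N. Hirata-Kohno, M. Kawashima, *Can polylogarithms at algebraic points be linearly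
independent?*, Moscow J. Comb. Number Th. 9 (2020) 389–406, Thm 2.1 [DavidHirataKohnoKawashima2020];
T. Rivoal, C. R. Acad. Sci. Paris 331 (2000), §2 Lemme 5 (the integrality mechanism) [Rivoal2000];
E. M. Nikišin, Mat. Sb. 109 (1979).
-/

open Finset

namespace Literature.NumberTheory.DiophantineApproximation

namespace ShiftPade

open Literature.NumberTheory.Transcendental

/-- **Integrality of the `Φ`-coefficients**: `d_n^w · coefM ∈ ℤ` for `o < w`, from
`d_n^{w−1−o} c_{o,p} ∈ ℤ` (the other factor `M^{p/m}` is a natural).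
[cite: Rivoal2000, §2 Lemme 5] -/
theorem isInt_lcmUpto_pow_mul_coefM {m w n : ℕ} {c : ℕ → ℕ → ℚ}
    (hc : BallRivoal.IsInt w (Nat.lcmUpto n) c) (M o r : ℕ) (ho : o < w) :
    ∃ z : ℤ, ((Nat.lcmUpto n : ℚ) ^ w) * coefM n m c M o r = z := by
  -- each summand is an integer
  have hterm : ∀ p ∈ range (n + 1), ∃ z : ℤ, ((Nat.lcmUpto n : ℚ) ^ w) *
      (if p % m + 1 = r then c o p * (M : ℚ) ^ (p / m) else 0) = z := by
    intro p _
    split_ifs with hp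
    · obtain ⟨z, hz⟩ := hc o p
      refine ⟨z * (Nat.lcmUpto n : ℤ) ^ (o + 1) * (M : ℤ) ^ (p / m), ?_⟩
      have hdw : (Nat.lcmUpto n : ℚ) ^ w =
          (Nat.lcmUpto n : ℚ) ^ (w - 1 - o) * (Nat.lcmUpto n : ℚ) ^ (o + 1) := by
        rw [← pow_add]; congr 1; omega
      rw [hdw]
      push_cast
      rw [← hz]
      ring
    · exact ⟨0, by simp⟩
  choose! z hz using hterm
  refine ⟨∑ p ∈ range (n + 1), z p, ?_⟩
  rw [coefM, mul_sum, Int.cast_sum]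
  exact sum_congr rfl fun p hp => hz p hp

/-- **Integrality of the constant term**: `d_n^w · constShift ∈ ℤ` (`m, M ≥ 1`), from
`d_n^{w−1−o} c_{o,p} ∈ ℤ` and `b^{o+1} ∣ d_n^{o+1}` for the denominators
`b = mk + p % m + 1` of the finite remainders: `k < p/m` gives
`1 ≤ b ≤ m(p/m) + p % m + 1 − m = p + 1 − m ≤ n`. [cite: Rivoal2000, §2 Lemme 5] -/
theorem isInt_lcmUpto_pow_mul_constShift {m w n : ℕ} {c : ℕ → ℕ → ℚ} (hm : 1 ≤ m)
    (hc : BallRivoal.IsInt w (Nat.lcmUpto n) c) {M : ℕ} (hM : 1 ≤ M) :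
    ∃ z : ℤ, ((Nat.lcmUpto n : ℚ) ^ w) * constShift n m w c M = z := by
  have hM0 : (M : ℚ) ≠ 0 := by exact_mod_cast (show M ≠ 0 by omega)
  -- the elementary summands `c_{o,p} M^{p/m}/(M^{k+1} (mk + p % m + 1)^{o+1})`, `k < p/m`,
  -- become integers
  have hel : ∀ o ∈ range w, ∀ p ∈ range (n + 1), ∀ k ∈ range (p / m),
      ∃ z : ℤ, ((Nat.lcmUpto n : ℚ) ^ w) *
        (c o p * ((M : ℚ) ^ (p / m) /
          ((M : ℚ) ^ (k + 1) * ((m : ℚ) * k + ((p % m + 1 : ℕ) : ℚ)) ^ (o + 1)))) = z := by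
    intro o ho p hp k hk
    rw [mem_range] at ho hp hk
    obtain ⟨z, hz⟩ := hc o p
    have hmk : m * k + m ≤ m * (p / m) := by
      have h := Nat.mul_le_mul_left m (Nat.succ_le_of_lt hk)
      rwa [Nat.mul_succ] at h
    have hdm := Nat.div_add_mod p m
    obtain ⟨e, he⟩ : (m * k + p % m + 1) ∣ Nat.lcmUpto n :=
      Int.natCast_dvd_natCast.1 (DilogPade.natCast_dvd_lcmUpto (by omega) (by omega))
    have hq : (m : ℚ) * k + ((p % m + 1 : ℕ) : ℚ) = ((m * k + p % m + 1 : ℕ) : ℚ) := by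
      push_cast; ring
    refine ⟨z * (e : ℤ) ^ (o + 1) * (M : ℤ) ^ (p / m - (k + 1)), ?_⟩
    have hdw : (Nat.lcmUpto n : ℚ) ^ w =
        (Nat.lcmUpto n : ℚ) ^ (w - 1 - o) * (Nat.lcmUpto n : ℚ) ^ (o + 1) := by
      rw [← pow_add]; congr 1; omega
    have hd' : (Nat.lcmUpto n : ℚ) ^ (o + 1) =
        ((m * k + p % m + 1 : ℕ) : ℚ) ^ (o + 1) * (e : ℚ) ^ (o + 1) := by
      rw [← mul_pow]; congr 1; exact_mod_cast he
    have hMp : (M : ℚ) ^ (p / m) = (M : ℚ) ^ (p / m - (k + 1)) * (M : ℚ) ^ (k + 1) := by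
      rw [← pow_add]; congr 1; omega
    rw [hq, hdw, hd', hMp]
    push_cast
    rw [← hz]
    field_simp
  -- sum over `k`
  have h1 : ∀ o ∈ range w, ∀ p ∈ range (n + 1), ∃ z : ℤ, ((Nat.lcmUpto n : ℚ) ^ w) *
      (c o p * ∑ k ∈ range (p / m), (M : ℚ) ^ (p / m) /
        ((M : ℚ) ^ (k + 1) * ((m : ℚ) * k + ((p % m + 1 : ℕ) : ℚ)) ^ (o + 1))) = z := by
    intro o ho p hp
    choose! z hz using hel o ho p hp
    refine ⟨∑ k ∈ range (p / m), z k, ?_⟩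
    rw [mul_sum, mul_sum, Int.cast_sum]
    exact sum_congr rfl fun k hk => hz k hk
  -- sum over `p`
  have h2 : ∀ o ∈ range w, ∃ z : ℤ, ((Nat.lcmUpto n : ℚ) ^ w) *
      (∑ p ∈ range (n + 1), c o p * ∑ k ∈ range (p / m), (M : ℚ) ^ (p / m) /
        ((M : ℚ) ^ (k + 1) * ((m : ℚ) * k + ((p % m + 1 : ℕ) : ℚ)) ^ (o + 1))) = z := by
    intro o ho
    choose! z hz using h1 o ho
    refine ⟨∑ p ∈ range (n + 1), z p, ?_⟩
    rw [mul_sum, Int.cast_sum]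
    exact sum_congr rfl fun p hp => hz p hp
  -- sum over `o`
  choose! z hz using h2
  refine ⟨-∑ o ∈ range w, z o, ?_⟩
  rw [constShift, mul_neg, mul_sum, Int.cast_neg, Int.cast_sum, neg_inj]
  exact sum_congr rfl fun o ho => hz o ho

/-- **Size of the `Φ`-coefficients**: `|coefM| ≤ (∑_{o,p} |c_{o,p}|) · M^{n/m}` for `M ≥ 1`, `o < w`
(`M^{p/m} ≤ M^{n/m}` in natural division). [folklore] -/
theorem abs_coefM_le {m w n : ℕ} (c : ℕ → ℕ → ℚ) {M : ℕ} (hM : 1 ≤ M) {o : ℕ} (ho : o < w)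
    (r : ℕ) : |coefM n m c M o r| ≤ BallRivoal.l1 n w c * (M : ℚ) ^ (n / m) := by
  have hM' : (1 : ℚ) ≤ M := by exact_mod_cast hM
  calc |coefM n m c M o r|
      ≤ ∑ p ∈ range (n + 1), |(if p % m + 1 = r then c o p * (M : ℚ) ^ (p / m) else 0)| :=
        abs_sum_le_sum_abs _ _
    _ ≤ ∑ p ∈ range (n + 1), |c o p| * (M : ℚ) ^ (n / m) := by
        refine sum_le_sum fun p hp => ?_
        have hMp : (M : ℚ) ^ (p / m) ≤ (M : ℚ) ^ (n / m) :=
          pow_le_pow_right₀ hM' (Nat.div_le_div_right (Nat.lt_succ_iff.1 (mem_range.1 hp)))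
        split_ifs with hpr
        · rw [abs_mul, abs_of_nonneg (by positivity : (0 : ℚ) ≤ (M : ℚ) ^ (p / m))]
          exact mul_le_mul_of_nonneg_left hMp (abs_nonneg _)
        · rw [abs_zero]; positivity
    _ = (∑ p ∈ range (n + 1), |c o p|) * (M : ℚ) ^ (n / m) := by rw [sum_mul]
    _ ≤ BallRivoal.l1 n w c * (M : ℚ) ^ (n / m) := by
        refine mul_le_mul_of_nonneg_right ?_ (by positivity)
        rw [BallRivoal.l1]
        calc ∑ p ∈ range (n + 1), |c o p|
            = ∑ p ∈ range (n + 1), ∑ o' ∈ ({o} : Finset ℕ), |c o' p| := by simp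
          _ ≤ ∑ p ∈ range (n + 1), ∑ o' ∈ range w, |c o' p| :=
              sum_le_sum fun p _ => sum_le_sum_of_subset_of_nonneg
                (by simpa using ho) fun _ _ _ => abs_nonneg _

/-- The crude bound on the factors of the `ℓ¹`-estimate of the `m`-shift kernel's partial-fraction
data: `∏_{s<w} m^{2n} 2^{(ms+3)n+1} ≤ m^{2nw} 2^{w((mw+3)n+1)}` (termwise `ms + 3 ≤ mw + 3` for `s < w`).
[folklore] -/
theorem prod_pow_two_pow_le_shiftM (m w n : ℕ) :
    ∏ s ∈ Finset.range w, ((m : ℚ) ^ (2 * n) * 2 ^ ((m * s + 3) * n + 1)) ≤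
      (m : ℚ) ^ (2 * n * w) * 2 ^ (w * ((m * w + 3) * n + 1)) := by
  calc ∏ s ∈ range w, ((m : ℚ) ^ (2 * n) * 2 ^ ((m * s + 3) * n + 1))
      ≤ ∏ s ∈ range w, ((m : ℚ) ^ (2 * n) * 2 ^ ((m * w + 3) * n + 1)) := by
        refine prod_le_prod (fun s _ => by positivity) fun s hs => ?_
        rw [mem_range] at hs
        exact mul_le_mul_of_nonneg_left (pow_le_pow_right₀ one_le_two
          (Nat.add_le_add_right (Nat.mul_le_mul_right n
            (Nat.add_le_add_right (Nat.mul_le_mul_left m hs.le) 3)) 1)) (by positivity)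
    _ = (m : ℚ) ^ (2 * n * w) * 2 ^ (w * ((m * w + 3) * n + 1)) := by
        rw [prod_const, card_range]
        ring

end ShiftPade

end Literature.NumberTheory.DiophantineApproximation
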